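import Literature.Geometry.Lorentzian.ConformalEquationAsymptotics
import Literature.Analysis.PDE.InteriorSupBound
import Literature.Geometry.Lorentzian.HarmonicallyFlatDecay
import HarnessLib

/-!
# Harmonic `L⁶` functions on a harmonically flat end tend to zero at infinity

The step "from the energy-space solution to the boundary condition at infinity" of the
construction of Green's / conformal potentials on asymptotically flat manifolds: Schoen–Yau,
Comm. Math. Phys. 65 (1979), proof of Lemma 3.2 (pp. 65–67), obtain from the `L⁶` bound (3.5)
and *"standard linear theory"* the pointwise decay (3.9) `|v| ≤ c r^{-1}`; Bray,
J. Differential Geom. 59 (2001), §6, uses the harmonic functions (81)/(86) with prescribed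
limits in the ends. Here, for an `h`-harmonic (far out) function `v ∈ L⁶(dV_h)` on a
harmonically flat end whose factor tends to `1`:

* `AFEnd.IsHarmonicallyFlatWith.isMetricAsymptoticallyFlat_one` — the metric part of asymptotic
  flatness of order `1` (from `isBigOSmooth_hCoeff_sub_innerSL`, without the time-symmetry used
  in `isAsymptoticallyFlat_one`);
* `AFEnd.IsHarmonicallyFlatWith.tendstoAtEnd_zero_of_memLp_six` — **`v → 0` at infinity in the
  end.** Proof: `W = 𝒰 · (v ∘ Φ)` is flat-harmonic far out (`harmonicAt_factor_mul_endValue`);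
  the scaled interior maximum estimate for the flat Laplacian
  (`Literature.Analysis.PDE.ball_estimates_three` with `ε = 0`, `G = 0`) bounds `W(x)²` by
  `C |x|⁻³ ∫_{B̄(x,|x|/4)} W²`, and `∫_{B̄(x,|x|/4)} (v∘Φ)² ≤ K₀ |x|²` for `v ∈ L⁶(dV_h)`
  (`AFEnd.exists_ball_sq_integral_le_of_memLp`, the tree's form of (3.5) ⇒ (3.9)); hence
  `|W(x)| ≤ C' |x|^{-1/2} → 0` and `v ∘ Φ = W/𝒰 → 0`.

Everything is proved; nothing is defined and no named fact is introduced.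

## References

* R. Schoen, S.-T. Yau, *On the proof of the positive mass conjecture in general relativity*,
  Comm. Math. Phys. 65 (1979) 45–76, proof of Lemma 3.2, (3.5)–(3.9). [SchoenYauPMT1979]
* H. L. Bray, *Proof of the Riemannian Penrose inequality using the positive mass theorem*,
  J. Differential Geom. 59 (2001) 177–267, §6, (81), (86). [BrayRPI2001]
* D. Gilbarg, N. S. Trudinger, *Elliptic partial differential equations of second order*
  (2001), Thm. 2.10, Thm. 8.17. [GilbargTrudinger2001]
-/

noncomputable section

open Set Function Filter Metric MeasureTheory Measure TopologicalSpace Bornology Asymptotics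
  Manifold Bundle InnerProductSpace
open scoped Topology Manifold ContDiff Laplacian Real

namespace Literature.Geometry.Lorentzian

open Literature.Analysis.PDE (ball_estimates_three)
open Literature.Analysis.FluidPDE.RieszKernel (powKer)

namespace AFEnd.IsHarmonicallyFlatWith

variable {X : Type} [TopologicalSpace X] [ChartedSpace E3 X] [IsManifold (𝓡 3) ∞ X]
  {e : AFEnd X} {D : InitialDataSet (𝓡 3) X} [D.metric.HasLeviCivita] {R₁ : ℝ} {𝒰 : E3 → ℝ}

/-- **A harmonically flat end whose factor tends to `1` is asymptotically flat of order `1` in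
the metric** (`h − δ = O₂(r⁻¹)`; the metric clause of `isAsymptoticallyFlat_one`, which needs
no condition on `k`). Bray 2001, §2 Def. 1 with (10). [cite: BrayRPI2001, §2 Def. 1 with (10)] -/
theorem isMetricAsymptoticallyFlat_one (hU : e.IsHarmonicallyFlatWith D R₁ 𝒰)
    (h1 : Tendsto 𝒰 (cobounded E3) (𝓝 1)) : e.IsMetricAsymptoticallyFlat D 1 := by
  intro m hm
  have h := (hU.isBigOSmooth_hCoeff_sub_innerSL h1 2).isBigO hm
  refine h.congr_right fun x ↦ ?_
  norm_num

variable [T2Space X] [LocallyCompactSpace X] [MeasurableSpace X] [BorelSpace X]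

/-- **`h`-harmonic `L⁶` functions on a harmonically flat end tend to `0` at infinity.** Let the
end `e` be harmonically flat beyond `R₁` with factor `𝒰 → 1`, and let `v ∈ C^∞(X) ∩ L⁶(dV_h)`
satisfy `Δ_h v = 0` at the chart points `Φ y`, `|y| > R₂`. Then `v(Φ x) → 0` as `|x| → ∞`.
(`W = 𝒰 · (v ∘ Φ)` is flat-harmonic far out; the interior maximum estimate on `B̄(x, |x|/4)`
and the `L²`-bound `∫_{B̄(x,|x|/4)} (v ∘ Φ)² ≤ K₀|x|²` coming from `v ∈ L⁶` give
`|W(x)| ≤ C |x|^{-1/2}`.) Schoen–Yau 1979, proof of Lemma 3.2, (3.5) ⇒ (3.9); this supplies the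
limits at infinity of the harmonic functions (81)/(86) of Bray 2001, §6, when they are produced
in the energy space. [cite: SchoenYauPMT1979, Lemma 3.2, (3.5)–(3.9)] [cite: BrayRPI2001, §6 (81)] -/
theorem tendstoAtEnd_zero_of_memLp_six (hHF : e.IsHarmonicallyFlatWith D R₁ 𝒰)
    (h1 : Tendsto 𝒰 (cobounded E3) (𝓝 1)) {v : X → ℝ} (hv : ContMDiff (𝓡 3) 𝓘(ℝ) ∞ v)
    (hv6 : MemLp v 6 (riemannianMeasure D.h)) {R₂ : ℝ}
    (hΔ : ∀ y : exteriorRegion e.R, R₂ < ‖(y : E3)‖ → D.metric.dalembertian v (e.dataChart y) = 0) :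
    TendstoAtEnd e v 0 := by
  classical
  set b : OrthonormalBasis (Fin 3) ℝ E3 := EuclideanSpace.basisFun (Fin 3) ℝ with hb
  -- the `L²` bound on quarter balls from `v ∈ L⁶`
  obtain ⟨K₀, r₀, hK₀, hI⟩ := e.exists_ball_sq_integral_le_of_memLp D one_pos
    (hHF.isMetricAsymptoticallyFlat_one h1) hv.continuous hv6
  -- the flat-harmonic function `W = 𝒰 · (v ∘ Φ)` on the shell `{ρ < |z|}`
  set ρ : ℝ := max (max R₁ R₂) e.R with hρ_def
  have hρ₁ : R₁ ≤ ρ := (le_max_left _ _).trans (le_max_left _ _)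
  have hρ₂ : R₂ ≤ ρ := (le_max_right _ _).trans (le_max_left _ _)
  have hρR : e.R ≤ ρ := le_max_right _ _
  set W : E3 → ℝ := fun z ↦ 𝒰 z * endValue e v z with hW_def
  set U : Set E3 := {z | ρ < ‖z‖} with hU_def
  have hUo : IsOpen U := isOpen_lt continuous_const continuous_norm
  have h2le : ((2 : ℕ) : ℕ∞ω) ≤ ∞ := WithTop.coe_le_coe.mpr le_top
  have hharm : ∀ z ∈ U, HarmonicAt W z := fun z hz ↦ by
    have hz' : max R₁ R₂ < ‖z‖ := lt_of_le_of_lt (le_max_left _ _) hz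
    exact hHF.harmonicAt_factor_mul_endValue (fun y _ ↦ (hv _).of_le h2le) hΔ hz'
  have hΔW : ∀ z ∈ U, (Δ W) z = 0 := fun z hz ↦ (hharm z hz).2.eq_of_nhds
  have hW3 : ContDiffOn ℝ 3 W U := fun z hz ↦ by
    have hz₁ : R₁ < ‖z‖ := lt_of_le_of_lt hρ₁ hz
    have hzR : e.R < ‖z‖ := lt_of_le_of_lt hρR hz
    have h3le : ((3 : ℕ) : ℕ∞ω) ≤ ∞ := natCast_le_infty 3
    have h𝒰 : ContDiffAt ℝ 3 𝒰 z := (hHF.contDiffAt_factor hz₁).of_le h3le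
    have hF : ContDiffAt ℝ 3 (endValue e v) z :=
      e.contDiffAt_endValue_of_contMDiffAt (n := 3) hzR ((hv _).of_le h3le)
    exact (h𝒰.mul hF).contDiffWithinAt
  -- `𝒰 ≤ 2` and `𝒰 ≥ 1/2` far out
  have hev : ∀ᶠ z in cobounded E3, 𝒰 z ∈ Ioo (1 / 2 : ℝ) 2 :=
    h1 (Ioo_mem_nhds (by norm_num) (by norm_num))
  obtain ⟨R𝒰, hR𝒰⟩ := exists_radius_of_eventually_cobounded hev
  -- the interior estimate
  obtain ⟨M, hM1, hest⟩ := ball_estimates_three b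
  set c₀ : ℝ := 3 * (∫⁻ u in ball (0 : E3) 1, powKer 2 u).toReal / (16 * π ^ 2) with hc₀_def
  have hc₀ : 0 ≤ c₀ := by
    have : 0 ≤ (∫⁻ u in ball (0 : E3) 1, powKer 2 u).toReal := ENNReal.toReal_nonneg
    positivity
  set C₁ : ℝ := c₀ * (46000 * ((3 : ℝ) + 1) ^ 3) * M ^ 4 * (64 * K₀) with hC₁_def
  have hC₁ : 0 ≤ C₁ := by positivity
  -- the bound `W(x)² ≤ 4 C₁ / |x|` far out
  set T : ℝ := max (max r₀ 1) (2 * (|ρ| + |R𝒰| + 1)) with hT_def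
  have hbound : ∀ x : E3, T ≤ ‖x‖ → W x ^ 2 ≤ 4 * C₁ * ‖x‖⁻¹ := by
    intro x hx
    have hx1 : 1 ≤ ‖x‖ := ((le_max_right r₀ 1).trans (le_max_left _ _)).trans hx
    have hx0 : 0 < ‖x‖ := one_pos.trans_le hx1
    have hxr₀ : r₀ ≤ ‖x‖ := ((le_max_left r₀ 1).trans (le_max_left _ _)).trans hx
    have hxT : 2 * (|ρ| + |R𝒰| + 1) ≤ ‖x‖ := (le_max_right _ _).trans hx
    set σ : ℝ := 1 / 4 * ‖x‖ with hσ_def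
    have hσ : 0 < σ := by positivity
    -- the closed ball `B̄(x, σ)` lies in the shell, where `1/2 < 𝒰 < 2`
    have hball : ∀ z ∈ closedBall x σ, ρ < ‖z‖ ∧ R𝒰 < ‖z‖ := by
      intro z hz
      rw [mem_closedBall, dist_eq_norm] at hz
      have h1 : ‖x‖ ≤ ‖z‖ + ‖z - x‖ := by
        have := norm_add_le z (x - z)
        rw [add_sub_cancel] at this
        rwa [norm_sub_rev]
      have hz3 : 3 / 4 * ‖x‖ ≤ ‖z‖ := by rw [hσ_def] at hz; linarith
      constructor
      · have : |ρ| < 3 / 4 * ‖x‖ := by linarith [abs_nonneg ρ, abs_nonneg R𝒰]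
        exact (le_abs_self ρ).trans_lt (this.trans_le hz3)
      · have : |R𝒰| < 3 / 4 * ‖x‖ := by linarith [abs_nonneg ρ, abs_nonneg R𝒰]
        exact (le_abs_self R𝒰).trans_lt (this.trans_le hz3)
    have hKU : closedBall x σ ⊆ U := fun z hz ↦ (hball z hz).1
    have hhyp : ∀ z ∈ closedBall x σ, |(Δ W) z| ≤
        0 * Real.sqrt (∑ i, ∑ j, (fderiv ℝ (fun y => fderiv ℝ W y (b i)) z (b j)) ^ 2)
          + M / σ * Real.sqrt (∑ i, (fderiv ℝ W z (b i)) ^ 2) + (M / σ) ^ 2 * |W z|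
          + (fun _ ↦ (0 : ℝ)) z := by
      intro z hz
      rw [hΔW z (hKU hz), abs_zero]
      have hM0 : 0 ≤ M / σ := div_nonneg (by linarith) hσ.le
      positivity
    obtain ⟨-, -, hsup⟩ := hest U W (fun _ ↦ 0) x σ 0 hUo hKU hW3 hσ le_rfl (by norm_num)
      continuous_const hhyp
    have hx_mem : x ∈ closedBall x (σ / 2) := mem_closedBall_self (by positivity)
    have key := hsup x hx_mem
    -- `∫_{B̄(x,σ)} W² ≤ 4 K₀ |x|² = 64 K₀ σ²`
    have hWsq : ∀ z ∈ closedBall x σ, W z ^ 2 ≤ 4 * endValue e v z ^ 2 := by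
      intro z hz
      obtain ⟨-, hz𝒰⟩ := hball z hz
      have h𝒰z := hR𝒰 z hz𝒰
      have h𝒰2 : 𝒰 z ^ 2 ≤ 4 := by nlinarith [h𝒰z.1, h𝒰z.2]
      show (𝒰 z * endValue e v z) ^ 2 ≤ 4 * endValue e v z ^ 2
      rw [mul_pow]
      exact mul_le_mul_of_nonneg_right h𝒰2 (sq_nonneg _)
    have hcont_ev : ContinuousOn (fun z ↦ endValue e v z ^ 2) (closedBall x σ) := by
      refine ContinuousOn.pow (fun z hz ↦ ?_) 2
      have hzR : e.R < ‖z‖ := lt_of_le_of_lt hρR (hball z hz).1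
      exact (e.contDiffAt_endValue_of_contMDiffAt (n := 0) hzR
        ((hv _).of_le (natCast_le_infty 0))).continuousAt.continuousWithinAt
    have hcont_W : ContinuousOn (fun z ↦ W z ^ 2) (closedBall x σ) :=
      (hW3.continuousOn.mono hKU).pow 2
    have hint : ∫ z in closedBall x σ, W z ^ 2 ≤ 4 * (K₀ * ‖x‖ ^ (2 : ℝ)) := by
      calc ∫ z in closedBall x σ, W z ^ 2 ≤ ∫ z in closedBall x σ, 4 * endValue e v z ^ 2 :=
            setIntegral_mono_on (hcont_W.integrableOn_compact (isCompact_closedBall _ _))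
              ((hcont_ev.integrableOn_compact (isCompact_closedBall _ _)).const_mul 4)
              measurableSet_closedBall hWsq
        _ = 4 * ∫ z in closedBall x σ, endValue e v z ^ 2 := integral_const_mul _ _
        _ ≤ 4 * (K₀ * ‖x‖ ^ (2 : ℝ)) := by
            refine mul_le_mul_of_nonneg_left ?_ (by norm_num)
            have := hI x hxr₀
            rwa [← hσ_def] at this
    have hx2 : ‖x‖ ^ (2 : ℝ) = (4 * σ) ^ 2 := by
      rw [Real.rpow_two, hσ_def]; ring
    rw [hx2] at hint
    -- assemble
    have hcard : ((Fintype.card (Fin 3) : ℝ) + 1) ^ 3 = ((3 : ℝ) + 1) ^ 3 := by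
      rw [Fintype.card_fin]; norm_num
    have hzero : ∫ z in closedBall x σ, (fun _ : E3 ↦ (0 : ℝ)) z ^ 2 = 0 := by simp
    rw [hzero, mul_zero, add_zero, hcard] at key
    have hMσ : (M / σ) ^ 4 = M ^ 4 * (σ ^ 4)⁻¹ := by rw [div_pow, div_eq_mul_inv]
    have hσx : ‖x‖⁻¹ = (4 * σ)⁻¹ := by rw [hσ_def]; ring
    rw [hσx]
    calc W x ^ 2 ≤ c₀ * σ * (46000 * ((3 : ℝ) + 1) ^ 3 * (M / σ) ^ 4 *
          ∫ z in closedBall x σ, W z ^ 2) := key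
      _ ≤ c₀ * σ * (46000 * ((3 : ℝ) + 1) ^ 3 * (M / σ) ^ 4 * (4 * (K₀ * (4 * σ) ^ 2))) := by
          gcongr
      _ = 4 * C₁ * (4 * σ)⁻¹ := by
          rw [hC₁_def, hMσ]
          field_simp
          ring
  -- `W → 0`
  have hWt : Tendsto W (cobounded E3) (𝓝 0) := by
    refine squeeze_zero_norm' (a := fun x ↦ Real.sqrt (4 * C₁) * Real.sqrt ‖x‖⁻¹) ?_ ?_
    · filter_upwards [eventually_cobounded_le_norm (E := E3) T] with x hx
      rw [Real.norm_eq_abs, ← Real.sqrt_sq_eq_abs, ← Real.sqrt_mul (by positivity)]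
      exact Real.sqrt_le_sqrt (hbound x hx)
    · have h0 : Tendsto (fun x : E3 ↦ Real.sqrt ‖x‖⁻¹) (cobounded E3) (𝓝 0) := by
        have := (Real.continuous_sqrt.tendsto 0).comp HasHarmonicExpansion.tendsto_inv_norm_cobounded
        rwa [Function.comp_def, Real.sqrt_zero] at this
      simpa using h0.const_mul (Real.sqrt (4 * C₁))
  -- `v ∘ Φ = W / 𝒰 → 0 / 1`
  have hquot : Tendsto (fun z ↦ W z * (𝒰 z)⁻¹) (cobounded E3) (𝓝 0) := by
    have := hWt.mul (h1.inv₀ one_ne_zero)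
    rwa [zero_mul] at this
  refine (hquot.congr' ?_)
  filter_upwards [eventually_cobounded_lt_norm (E := E3) R𝒰] with z hz
  have h𝒰0 : 𝒰 z ≠ 0 := by have := (hR𝒰 z hz).1; positivity
  show 𝒰 z * endValue e v z * (𝒰 z)⁻¹ = endValue e v z
  field_simp

end AFEnd.IsHarmonicallyFlatWith

end Literature.Geometry.Lorentzian

end
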